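import Literature.Topology.PlaneTopology.JordanCurve
import Literature.Probability.RandomPlanarGeometry.PlanarDomains
import HarnessLib


/-!
# Jordan domains: inside, outside and the exterior domain (consequences of the JCT)

For an `Literature.Probability.RandomPlanarGeometry.JordanDomain` `D` (open bounded connected `carrier` with a `1`-periodic continuous
boundary loop injective on `[0, 1)` whose range is `frontier carrier`), the Jordan curve theorem
(`Literature.Topology.PlaneTopology.JordanCurveTheorem`, vendored fact) identifies `D.carrier` with the inside of its boundary
curve and the exterior `(closure D.carrier)ᶜ` with the outside: the exterior is open, connected,
unbounded, and has the same frontier as `D` (Werner 2007, §2; McCleary 2006, Ch. 9). These are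
the facts used by the RSW corollary `Literature.Probability.Percolation.discreteCrossingProb_clusterPt_mem_Ioo`
(an open circuit around a boundary point must leave `Ω̄`). All statements take the Jordan curve
theorem as a hypothesis `(hJ : JordanCurveTheorem)` (a named Literature fact,
`Literature/Topology/PlaneTopology/JordanCurve.lean`), so this file is sorry-free.

A second section (no JCT needed) proves that the boundary arcs of an `Literature.Probability.RandomPlanarGeometry.MarkedDomain` tile the
boundary curve: `MarkedDomain.iUnion_arc_holds` discharges the named statement
`MarkedDomain.iUnion_arc` (`⋃ i, arc i = frontier`), interior points of an arc lie on no other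
arc (`boundary_not_mem_arc`, by injectivity of the loop on a period,
`injOn_boundary_Ico_mark_zero`) and have a neighbourhood meeting the boundary only in that arc
(`exists_pos_forall_mem_arc_of_dist_lt`) — the "interior boundary point of the arc `(ab)`" used
to anchor RSW circuits in the crossing-probability corollary.

Mathlib anchors: `frontier`, `closure`, `IsConnected`, `IsPreconnected.subset_or_subset`,
`IsPreconnected.subset_of_closure_inter_subset`, `Bornology.IsBounded`, `AddCircle`,
`Function.Periodic.exists_mem_Ico`, `Set.InjOn`, `Finset.max'`, `Metric.isOpen_iff`.

## References
* W. Werner, *Lectures on two-dimensional critical percolation*, IAS/Park City (2007), §2. [Werner2007]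
* J. McCleary, *A First Course in Topology: Continuity and Dimension*, AMS (2006), Ch. 9. [Mccleary2006]
-/

namespace Literature.Probability.RandomPlanarGeometry.JordanDomain

open Set _root_.Topology

variable (D : JordanDomain)

/-- The frontier of a Jordan domain is a Jordan curve: it is homeomorphic to the circle `ℝ/ℤ`
(through the boundary loop). [folklore] -/
theorem frontier_homeomorphic_addCircle : Nonempty (AddCircle (1 : ℝ) ≃ₜ frontier D.carrier) := by
  rw [← D.range_boundary]
  exact Literature.Topology.PlaneTopology.range_homeomorphic_addCircle D.continuous_boundary D.periodic_boundary D.injOn_boundary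

/-- The carrier of a Jordan domain does not meet its frontier (it is open). [folklore] -/
theorem disjoint_carrier_frontier : Disjoint D.carrier (frontier D.carrier) := by
  rw [Set.disjoint_iff]
  rintro z ⟨hz, hzf⟩
  rw [D.isOpen.frontier_eq] at hzf
  exact hzf.2 hz

/-- **Inside/outside of a Jordan domain** (from the Jordan curve theorem). The complement of the
boundary curve of `D` is `D.carrier ∪ V` for an open connected unbounded set `V` disjoint from
`D.carrier` with `frontier V = frontier D.carrier`; i.e. `D.carrier` is the inside of its boundary
curve. Proof: `D.carrier` is connected and misses the curve, so it lies in one complementary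
component `W`, in which it is clopen, hence `D.carrier = W`; being bounded, `W` is the inside.
(Werner 2007, §2; McCleary 2006, Ch. 9.) [folklore] -/
theorem exists_outside (hJ : Literature.Topology.PlaneTopology.JordanCurveTheorem) :
    ∃ V : Set ℂ, IsOpen V ∧ IsConnected V ∧ Disjoint D.carrier V ∧
      D.carrier ∪ V = (frontier D.carrier)ᶜ ∧ frontier V = frontier D.carrier ∧
      ¬ Bornology.IsBounded V := by
  obtain ⟨U, V, hUo, hVo, hUc, hVc, hUV, hunion, hfU, hfV, hUb, hVb⟩ :=
    hJ.of_periodic D.continuous_boundary D.periodic_boundary D.injOn_boundary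
  rw [D.range_boundary] at hunion hfU hfV
  -- `D.carrier` lies in `U ∪ V`
  have hDsub : D.carrier ⊆ U ∪ V := by
    rw [hunion]
    exact Set.disjoint_left.1 D.disjoint_carrier_frontier
  -- a complementary component containing a point of `D` is all of `D`
  have key : ∀ W : Set ℂ, IsConnected W → W ⊆ (frontier D.carrier)ᶜ → D.carrier ⊆ W →
      W ⊆ D.carrier := by
    intro W hW hWf hDW
    refine hW.isPreconnected.subset_of_closure_inter_subset D.isOpen ?_ ?_
    · obtain ⟨z, hz⟩ := D.nonempty
      exact ⟨z, hDW hz, hz⟩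
    · rintro z ⟨hzc, hzW⟩
      rw [closure_eq_self_union_frontier] at hzc
      exact hzc.resolve_right fun h => hWf hzW h
  rcases D.isConnected.isPreconnected.subset_or_subset hUo hVo hUV hDsub with hDU | hDV
  · have hDeq : D.carrier = U :=
      hDU.antisymm (key U hUc (hunion ▸ subset_union_left) hDU)
    refine ⟨V, hVo, hVc, hDeq ▸ hUV, by rw [← hunion, hDeq], hfV, hVb⟩
  · exact absurd (D.isBounded.subset (key V hVc (hunion ▸ subset_union_right) hDV)) hVb

/-- **The exterior of a Jordan domain** (from the Jordan curve theorem): `(closure D)ᶜ` is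
connected and unbounded and its frontier is the boundary curve `frontier D` — the outside of the
Jordan curve. (Werner 2007, §2; McCleary 2006, Ch. 9.) [folklore] -/
theorem exterior_of_JCT (hJ : Literature.Topology.PlaneTopology.JordanCurveTheorem) :
    IsConnected (closure D.carrier)ᶜ ∧ frontier (closure D.carrier)ᶜ = frontier D.carrier ∧
      ¬ Bornology.IsBounded (closure D.carrier)ᶜ := by
  obtain ⟨V, hVo, hVc, hDV, hunion, hfV, hVb⟩ := D.exists_outside hJ
  have hV : (closure D.carrier)ᶜ = V := by
    rw [closure_eq_self_union_frontier, compl_union]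
    ext z
    constructor
    · rintro ⟨hzD, hzf⟩
      have : z ∈ D.carrier ∪ V := by rw [hunion]; exact hzf
      exact this.resolve_left hzD
    · intro hzV
      refine ⟨fun hzD => Set.disjoint_left.1 hDV hzD hzV, ?_⟩
      have : z ∈ D.carrier ∪ V := Or.inr hzV
      rw [hunion] at this
      exact this
  rw [hV]
  exact ⟨hVc, hfV, hVb⟩

/-- Every boundary point of a Jordan domain is a limit of exterior points (from the Jordan curve
theorem: the outside has the curve as frontier). This is what forces an open lattice circuit
around a boundary point to leave `Ω̄`. [folklore] -/
theorem frontier_subset_closure_exterior (hJ : Literature.Topology.PlaneTopology.JordanCurveTheorem) :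
    frontier D.carrier ⊆ closure (closure D.carrier)ᶜ := by
  obtain ⟨-, hf, -⟩ := D.exterior_of_JCT hJ
  rw [← hf]
  exact frontier_subset_closure

end Literature.Probability.RandomPlanarGeometry.JordanDomain

namespace Literature.Probability.RandomPlanarGeometry.MarkedDomain

open Set Metric

variable {n : ℕ} (D : MarkedDomain n)

/-! ### The boundary arcs of a marked domain tile the boundary curve -/

/-- With `n ≥ 1` marks, the auxiliary index `⟨0, _⟩` used in `nextMark` is `0 : Fin n`. [folklore] -/
theorem mark_mk_zero [NeZero n] (h : 0 < n) : D.mark ⟨0, h⟩ = D.mark 0 :=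
  congrArg D.mark (Fin.ext (by simp))

/-- The first mark is the smallest. [folklore] -/
theorem mark_zero_le [NeZero n] (i : Fin n) : D.mark 0 ≤ D.mark i :=
  D.strictMono_mark.monotone (Fin.zero_le i)

/-- Every next mark is at most one period after the first mark. [folklore] -/
theorem nextMark_le_mark_zero_add_one [NeZero n] (i : Fin n) : D.nextMark i ≤ D.mark 0 + 1 := by
  unfold nextMark
  split_ifs with h
  · have := (D.mark_mem ⟨i.val + 1, h⟩).2
    have := (D.mark_mem 0).1
    linarith
  · rw [D.mark_mk_zero]

/-- `nextMark` of a non-final index is the next mark. [folklore] -/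
theorem nextMark_of_lt (i : Fin n) (h : i.val + 1 < n) : D.nextMark i = D.mark ⟨i.val + 1, h⟩ := by
  unfold nextMark
  rw [dif_pos h]

/-- `nextMark` of the final index wraps around to `mark 0 + 1`. [folklore] -/
theorem nextMark_of_not_lt [NeZero n] (i : Fin n) (h : ¬ i.val + 1 < n) :
    D.nextMark i = D.mark 0 + 1 := by
  unfold nextMark
  rw [dif_neg h, D.mark_mk_zero]

/-- The boundary loop is injective on the shifted period `[mark 0, mark 0 + 1)`. [folklore] -/
theorem injOn_boundary_Ico_mark_zero [NeZero n] :
    InjOn D.boundary (Ico (D.mark 0) (D.mark 0 + 1)) := by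
  have h0 := (D.mark_mem 0).1
  have h1 := (D.mark_mem 0).2
  -- reduce a parameter of `[mark 0, mark 0 + 1)` to the fundamental period
  have red : ∀ s ∈ Ico (D.mark 0) (D.mark 0 + 1),
      ∃ s' ∈ Ico (0 : ℝ) 1, D.boundary s' = D.boundary s ∧ (s' = s ∨ s' = s - 1) := by
    intro s hs
    by_cases hs1 : s < 1
    · exact ⟨s, ⟨h0.trans hs.1, hs1⟩, rfl, Or.inl rfl⟩
    · refine ⟨s - 1, ⟨by linarith, by linarith [hs.2]⟩, ?_, Or.inr rfl⟩
      have := D.periodic_boundary (s - 1)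
      rw [sub_add_cancel] at this
      exact this.symm
  intro s hs s' hs' heq
  obtain ⟨u, hu, hbu, hcase⟩ := red s hs
  obtain ⟨u', hu', hbu', hcase'⟩ := red s' hs'
  have huu' : u = u' := D.injOn_boundary hu hu' (by rw [hbu, hbu', heq])
  have hs1 := hs.1; have hs2 := hs.2; have hs'1 := hs'.1; have hs'2 := hs'.2
  rcases hcase with h | h <;> rcases hcase' with h' | h' <;> subst h <;> linarith

/-- **The boundary arcs cover the boundary curve** (discharge of `MarkedDomain.iUnion_arc`): the
parameter intervals `[mark i, nextMark i]` tile the period `[mark 0, mark 0 + 1]`.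
(Werner 2007, §3.) [cite: Werner2007, §3] -/
theorem iUnion_arc_holds : D.iUnion_arc := by
  intro _
  refine (iUnion_subset fun i => D.arc_subset_frontier i).antisymm ?_
  rw [← D.range_boundary]
  rintro _ ⟨t, rfl⟩
  -- reduce the parameter to `[mark 0, mark 0 + 1)`
  obtain ⟨s, hs, hst⟩ := D.periodic_boundary.exists_mem_Ico one_pos t (D.mark 0)
  rw [hst]
  -- the last mark below `s`
  classical
  set F : Finset (Fin n) := Finset.univ.filter fun i => D.mark i ≤ s with hF
  have hFne : F.Nonempty := ⟨0, by simp [hF, hs.1]⟩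
  set i := F.max' hFne with hi
  have hiF : i ∈ F := F.max'_mem hFne
  have hile : D.mark i ≤ s := (Finset.mem_filter.1 hiF).2
  have hsle : s ≤ D.nextMark i := by
    by_cases h : i.val + 1 < n
    · rw [D.nextMark_of_lt i h]
      by_contra hlt
      have hjF : (⟨i.val + 1, h⟩ : Fin n) ∈ F := by
        simp only [hF, Finset.mem_filter, Finset.mem_univ, true_and]
        exact (not_le.1 hlt).le
      have := F.le_max' _ hjF
      rw [← hi, Fin.le_def] at this
      simp at this
    · rw [D.nextMark_of_not_lt i h]
      exact hs.2.le
  exact mem_iUnion.2 ⟨i, ⟨s, ⟨hile, hsle⟩, rfl⟩⟩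

/-- The open parameter interval of arc `i` misses the closed parameter interval of every other
arc `j` (they tile the period with only endpoints in common). [folklore] -/
theorem not_mem_Icc_of_mem_Ioo [NeZero n] {i j : Fin n} (hij : j ≠ i) {t : ℝ}
    (ht : t ∈ Ioo (D.mark i) (D.nextMark i)) : t ∉ Icc (D.mark j) (D.nextMark j) := by
  rintro ⟨h1, h2⟩
  rcases lt_or_gt_of_ne hij with h | h
  · -- `j < i`: then `nextMark j = mark (j+1) ≤ mark i < t`
    have hj : j.val + 1 < n := lt_of_le_of_lt (Nat.succ_le_of_lt (Fin.lt_def.1 h)) i.isLt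
    rw [D.nextMark_of_lt j hj] at h2
    have : D.mark ⟨j.val + 1, hj⟩ ≤ D.mark i :=
      D.strictMono_mark.monotone (Fin.mk_le_of_le_val (Nat.succ_le_of_lt (Fin.lt_def.1 h)))
    linarith [ht.1]
  · -- `i < j`: then `t < nextMark i = mark (i+1) ≤ mark j`
    have hi : i.val + 1 < n := lt_of_le_of_lt (Nat.succ_le_of_lt (Fin.lt_def.1 h)) j.isLt
    have h3 := ht.2
    rw [D.nextMark_of_lt i hi] at h3
    have : D.mark ⟨i.val + 1, hi⟩ ≤ D.mark j :=
      D.strictMono_mark.monotone (Fin.mk_le_of_le_val (Nat.succ_le_of_lt (Fin.lt_def.1 h)))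
    linarith

/-- **Interior points of an arc are off the other arcs.** A boundary point whose parameter is
strictly between `mark i` and `nextMark i` does not lie on any other arc `arc j`, `j ≠ i`
(injectivity of the boundary loop on a period). [folklore] -/
theorem boundary_not_mem_arc [NeZero n] {i j : Fin n} (hij : j ≠ i) {t : ℝ}
    (ht : t ∈ Ioo (D.mark i) (D.nextMark i)) : D.boundary t ∉ D.arc j := by
  rintro ⟨s, hs, hst⟩
  have htI : t ∈ Ico (D.mark 0) (D.mark 0 + 1) :=
    ⟨(D.mark_zero_le i).trans ht.1.le, ht.2.trans_le (D.nextMark_le_mark_zero_add_one i)⟩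
  have hs0 : D.mark 0 ≤ s := (D.mark_zero_le j).trans hs.1
  have hs1 : s ≤ D.mark 0 + 1 := hs.2.trans (D.nextMark_le_mark_zero_add_one j)
  rcases hs1.lt_or_eq with hs1 | hs1
  · -- `s` in the shifted period: injectivity forces `s = t`, contradicting the tiling
    have hseq : s = t := D.injOn_boundary_Ico_mark_zero ⟨hs0, hs1⟩ htI hst
    exact D.not_mem_Icc_of_mem_Ioo hij ht (hseq ▸ hs)
  · -- `s = mark 0 + 1`: then `boundary s = boundary (mark 0)` and `mark 0 ≠ t`
    have hb : D.boundary (D.mark 0) = D.boundary t := by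
      rw [← hst, hs1, D.periodic_boundary]
    have h0I : D.mark 0 ∈ Ico (D.mark 0) (D.mark 0 + 1) := ⟨le_rfl, by linarith⟩
    have h0t : D.mark 0 = t := D.injOn_boundary_Ico_mark_zero h0I htI hb
    -- but `t ∈ Ioo (mark i) _` with `mark 0 ≤ mark i`
    have := D.mark_zero_le i
    linarith [ht.1]

/-- **Interior points of an arc have a neighbourhood meeting the boundary only in that arc.**
For `t` strictly between `mark i` and `nextMark i` there is `r > 0` such that every boundary
point within distance `r` of `boundary t` lies on `arc i`; moreover every point of the other
arcs is at distance at least `r`. (The other arcs form a compact set missing `boundary t`.)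
[folklore] -/
theorem exists_pos_forall_mem_arc_of_dist_lt [NeZero n] (i : Fin n) {t : ℝ}
    (ht : t ∈ Ioo (D.mark i) (D.nextMark i)) :
    ∃ r > 0, (∀ z ∈ frontier D.carrier, dist z (D.boundary t) < r → z ∈ D.arc i) ∧
      ∀ j, j ≠ i → ∀ z ∈ D.arc j, r ≤ dist z (D.boundary t) := by
  set S : Set ℂ := ⋃ j ∈ {j : Fin n | j ≠ i}, D.arc j with hS
  have hSc : IsClosed S := (Set.toFinite _).isClosed_biUnion fun j _ => D.isClosed_arc j
  have htS : D.boundary t ∉ S := by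
    simp only [hS, mem_iUnion, mem_setOf_eq, exists_prop, not_exists, not_and]
    exact fun j hj => D.boundary_not_mem_arc hj ht
  obtain ⟨r, hr, hball⟩ := Metric.isOpen_iff.1 hSc.isOpen_compl _ htS
  refine ⟨r, hr, fun z hz hzr => ?_, fun j hj z hz => ?_⟩
  · have hzS : z ∉ S := hball (mem_ball.2 hzr)
    have hz' : z ∈ ⋃ k, D.arc k := by rw [D.iUnion_arc_holds]; exact hz
    obtain ⟨k, hk⟩ := mem_iUnion.1 hz'
    by_contra hzi
    have hki : k ≠ i := fun h => hzi (h ▸ hk)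
    exact hzS (mem_biUnion (show k ∈ {j : Fin n | j ≠ i} from hki) hk)
  · by_contra hlt
    exact hball (mem_ball.2 (not_le.1 hlt)) (mem_biUnion (show j ∈ {j : Fin n | j ≠ i} from hj) hz)

/-- The midpoint parameter of arc `i` is strictly inside its parameter interval, so every arc
has interior points (in the sense of `boundary_not_mem_arc`). [folklore] -/
theorem midpoint_mem_Ioo (i : Fin n) :
    (D.mark i + D.nextMark i) / 2 ∈ Ioo (D.mark i) (D.nextMark i) := by
  have := D.mark_lt_nextMark i
  constructor <;> linarith

/-- Boundary points of an open set are limits of interior points: for a Jordan domain, every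
point of an arc is approached by points of the domain. [folklore] -/
theorem exists_mem_carrier_dist_lt (i : Fin n) {z : ℂ} (hz : z ∈ D.arc i) {ε : ℝ} (hε : 0 < ε) :
    ∃ w ∈ D.carrier, dist w z < ε := by
  have hzc : z ∈ closure D.carrier := frontier_subset_closure (D.arc_subset_frontier i hz)
  obtain ⟨w, hw, hwd⟩ := Metric.mem_closure_iff.1 hzc ε hε
  exact ⟨w, hw, by rwa [dist_comm]⟩

end Literature.Probability.RandomPlanarGeometry.MarkedDomain
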